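import Summits.CriticalPhenomena.SAWScalingLimit.Theorems.SAWDevelopingMapHexConjectureKPDichotomy
import Summits.CriticalPhenomena.SAWScalingLimit.Theorems.SAWDevelopingMapHexConjectureKPAnalyticLocal
import Summits.CriticalPhenomena.SAWScalingLimit.Theorems.SAWDevelopingMapHexConjectureKPTransferAt
import HarnessLib

/-!
# Crux `HexConjecture` (stmt-CriticalPhenomena-0808), line `root-locality-replaces-loewner`:
the window two-point lower bound AT ONE RADIUS from lower regularity ON COMPARABLE SCALES

Landing target:
`Summits/CriticalPhenomena/SAWScalingLimit/Theorems/SAWDevelopingMapHexConjectureWindowTwoPointAtScale.lean`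
(`--supports stmt-CriticalPhenomena-0808`; lead prover-line-stmt-CriticalPhenomena-0808-c10-0).

The lever of the line is the WINDOW TWO-POINT LOWER BOUND `WTLB` (skeleton statement 2♮♮): for some
`0 < θa < θb ≤ 1/4`, one constant `C` and all large `R`,
`triDl ⌊R/4⌋ ≤ C · Σ_{d ∈ [θa R, θb R]} Z_{B_R(x)}(s_x → t_{x + d e₀})`.  Seat c9 reduced it to the GLOBAL
lower regularity `REG : ∃ C, ∀ T ≥ 1, Σ_{i ≤ T} triDl i ≤ C (T+1) triDl T` of the Glazman–Manolescu
triangle tail (`stub_windowTwoPointLowerBound_of_reg`, Krachun–Panagiotis 2023 §3 in confined form).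

This file makes the reduction SCALE-LOCAL (`windowTwoPointLowerBoundAt_of_regNear`): for every
`K ≥ 1` there is ONE constant `C = C(K) > 0` such that, for every radius `R ≥ 600`, the window
inequality at `R` (with `θa = 1/168`, `θb = 1/4`) follows from the regularity inequality
`Σ_{i ≤ s} triDl i ≤ K (s+1) triDl s` at the finitely many scales `s` comparable to `R`, namely
`⌈R/168⌉ ≤ 4 (s+1)` and `s ≤ 5 ⌈R/168⌉` (i.e. `s ∈ [R/672 - 1, 5R/168 + 5]`).  It composes the two
registered sub-goals `stub_kp_analytic_local` (KP's analytic step with REG only at those scales, file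
`…KPAnalyticLocal`) and `stub_kp_transfer_at` (the pointwise strip → half-box transfer, file
`…KPTransferAt`) over the dichotomy of constructions (a)/(b) (`stub_kp_dichotomy`).  Consequences
recorded here:

* `windowTwoPointLowerBound_of_regEventually` — `WTLB` from REG at all LARGE scales only (any `s₀`);
* the companion file `…DoublingEventually` derives REG, hence `WTLB`, from the doubling inequality
  `q · triDl T ≤ triDl (2T)` for all LARGE `T` with some `q > 1/2`.

So the open content of the lever is, scale by scale, the boundedness of the regularity ratio
`r(s) = Σ_{i ≤ s} triDl i / ((s+1) triDl s)` on the scales comparable to the radius — the interface a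
"good scales" (adaptive-radius) version of the bootstrap would consume.
-/

noncomputable section

open scoped BigOperators Topology Classical
open Finset
open Literature.Probability.LatticeModels (HexVertex hexGraph hexCenter Site)
open Literature.Probability.RandomPlanarGeometry
open Literature.Probability.RandomPlanarGeometry.SAW
open Literature.Probability.RandomPlanarGeometry.SAW.HV

namespace Summit.CriticalPhenomena.SAWScalingLimit.Theorems.HexConjecture.RootLocality

/-! ### The scale-local reduction -/

/-- **THE WINDOW TWO-POINT LOWER BOUND AT ONE RADIUS FROM LOWER REGULARITY ON COMPARABLE SCALES.**
For every `K ≥ 1` there is `C > 0` such that for every `R ≥ 600`: if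
`Σ_{i ≤ s} triDl i ≤ K (s+1) triDl s` for all scales `s` with `⌈R/168⌉ ≤ 4(s+1)` and `s ≤ 5⌈R/168⌉`,
then for every cell `x`, the upper half-box `B = {v : rows ≥ x₁, |c_v - mid s_x| ≤ R}` and the
lattice window `S' = [R/168, R/4] ∩ ℤ`,
`triDl ⌊R/4⌋ ≤ C · Σ_{d ∈ S'} Z_B(s_x → t_{x + d e₀})`.
(`stub_kp_analytic_local` at `T = ⌈R/168⌉` over `stub_kp_dichotomy`, then `stub_kp_transfer_at`.)
[cite: KrachunPanagiotis2026, §3 (Lemmas 3.1–3.3, Corollary 3.1); GlazmanManolescu2019, §4.1] -/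
theorem windowTwoPointLowerBoundAt_of_regNear : ∀ K : ℝ, 1 ≤ K → ∃ C : ℝ, 0 < C ∧
    ∀ R : ℝ, 600 ≤ R →
    (∀ s : ℕ, ⌈R / 168⌉₊ ≤ 4 * (s + 1) → s ≤ 5 * ⌈R / 168⌉₊ →
      ∑ i ∈ Finset.range (s + 1), triDl i ≤ K * ((s : ℝ) + 1) * triDl s) →
    ∀ (x : Site 2) (B : Finset HexVertex) (S' : Finset ℤ),
      (∀ v : HexVertex, v ∈ B ↔ (x 1 ≤ v.1 1 ∧
        dist (hexCenter v) (hexMidpoint s((x - Pi.single 1 1, 1), (x, 0))) ≤ R)) →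
      (∀ d : ℤ, d ∈ S' ↔ ((1 / 168 : ℝ) * R ≤ (d : ℝ) ∧ (d : ℝ) ≤ (1 / 4 : ℝ) * R)) →
      triDl ⌊R / 4⌋₊ ≤ C * ∑ d ∈ S', ∑ γ : HexMidEdgeSAW B s((x - Pi.single 1 1, 1), (x, 0))
          s((x + Pi.single 0 d - Pi.single 1 1, 1), (x + Pi.single 0 d, 0)),
          hexCriticalFugacity ^ γ.length := by
  intro K hK
  obtain ⟨c, hc, hmain⟩ :=
    stub_kp_analytic_local K _ _ hK
      (div_pos cos_pi_div_eight_pos (mul_pos (by norm_num) cos_pi_div_four_pos') :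
        0 < Real.cos (Real.pi / 8) / (16 * Real.cos (Real.pi / 4)))
      (by norm_num : (0 : ℝ) < 15 / 64)
  refine ⟨c⁻¹, inv_pos.2 hc, fun R hR hloc x B S' hB hS' => ?_⟩
  set W : ℕ → ℝ := fun T => ∑ d ∈ Finset.Icc (T : ℤ) (21 * T),
    ∑ P ∈ (midWalks (stripV (32 * T + 1) (32 * T + 1))).filter
      (fun P => finalDart P = ((d, 0, false), (d, -1, true)) ∨
        finalDart P = ((d, -1, true), (d, 0, false))), hexCriticalFugacity ^ mwLen P with hWdef
  have hT1 : 1 ≤ ⌈R / 168⌉₊ := Nat.one_le_ceil_iff.2 (by positivity)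
  have hstrip : c * triDl (9 * ⌈R / 168⌉₊) ≤ W ⌈R / 168⌉₊ :=
    hmain W ⌈R / 168⌉₊ hT1 hloc
      (fun M₁ M₂ h₁ h₂ => stub_kp_dichotomy ⌈R / 168⌉₊ hT1 M₁ M₂ h₁ h₂)
  exact stub_kp_transfer_at W (fun T => rfl) c R hc hR hstrip x B S' hB hS'

/-- **`WTLB` from lower regularity at all LARGE scales**: if `Σ_{i ≤ s} triDl i ≤ K (s+1) triDl s` for
all `s ≥ s₀` (some `K ≥ 1`), then the window two-point lower bound holds (with `θa = 1/168`,
`θb = 1/4`, `R₀ = max 600 (672 (s₀ + 1))`). [cite: KrachunPanagiotis2026, §3] -/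
theorem windowTwoPointLowerBound_of_regEventually {K : ℝ} (hK : 1 ≤ K) {s₀ : ℕ}
    (hreg : ∀ s : ℕ, s₀ ≤ s → ∑ i ∈ Finset.range (s + 1), triDl i ≤ K * ((s : ℝ) + 1) * triDl s) :
    ∃ θa θb C : ℝ, 0 < θa ∧ θa < θb ∧ θb ≤ 1 / 4 ∧ 0 < C ∧ ∃ R₀ : ℝ, 0 < R₀ ∧ ∀ R : ℝ, R₀ ≤ R → ∀ (x : Literature.Probability.LatticeModels.Site 2) (B : Finset Literature.Probability.LatticeModels.HexVertex) (S' : Finset ℤ), (∀ v : Literature.Probability.LatticeModels.HexVertex, v ∈ B ↔ (x 1 ≤ v.1 1 ∧ dist (Literature.Probability.LatticeModels.hexCenter v) (Literature.Probability.RandomPlanarGeometry.SAW.hexMidpoint s((x - Pi.single 1 1, 1), (x, 0))) ≤ R)) → (∀ d : ℤ, d ∈ S' ↔ (θa * R ≤ (d : ℝ) ∧ (d : ℝ) ≤ θb * R)) → Literature.Probability.RandomPlanarGeometry.SAW.HV.triDl ⌊R / 4⌋₊ ≤ C * ∑ d ∈ S', ∑ γ : Literature.Probability.RandomPlanarGeometry.SAW.HexMidEdgeSAW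 B s((x - Pi.single 1 1, 1), (x, 0)) s((x + Pi.single 0 d - Pi.single 1 1, 1), (x + Pi.single 0 d, 0)), Literature.Probability.RandomPlanarGeometry.SAW.hexCriticalFugacity ^ γ.length := by
  obtain ⟨C, hC, hAt⟩ := windowTwoPointLowerBoundAt_of_regNear K hK
  refine ⟨1 / 168, 1 / 4, C, by norm_num, by norm_num, le_rfl, hC, max 600 (672 * ((s₀ : ℝ) + 1)),
    lt_max_of_lt_left (by norm_num), fun R hR x B S' hB hS' => ?_⟩
  have hR600 : (600 : ℝ) ≤ R := (le_max_left _ _).trans hR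
  have hRs : 672 * ((s₀ : ℝ) + 1) ≤ R := (le_max_right _ _).trans hR
  refine hAt R hR600 (fun s hs _ => hreg s ?_) x B S' hB hS'
  -- `s₀ ≤ s`: from `⌈R/168⌉ ≤ 4 (s+1)` and `R ≥ 672 (s₀+1)`
  have h1 : R / 168 ≤ ((⌈R / 168⌉₊ : ℕ) : ℝ) := Nat.le_ceil _
  have h2 : ((⌈R / 168⌉₊ : ℕ) : ℝ) ≤ 4 * ((s : ℝ) + 1) := by exact_mod_cast hs
  exact_mod_cast (show (s₀ : ℝ) ≤ s by linarith)

/-- **Registered sub-goal `stub_wtlbAt_of_regNear`** (crux item stmt-CriticalPhenomena-0808, line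
`root-locality-replaces-loewner`): the scale-local reduction, fully qualified — for every `K ≥ 1` there is
`C > 0` such that for every `R ≥ 600`, lower regularity with constant `K` at the scales `s` with
`⌈R/168⌉ ≤ 4(s+1)`, `s ≤ 5⌈R/168⌉` gives the window inequality at `R` (`θa = 1/168`, `θb = 1/4`).
[cite: KrachunPanagiotis2026, §3 (Lemmas 3.1–3.3, Corollary 3.1); GlazmanManolescu2019, §4.1] -/
theorem stub_wtlbAt_of_regNear : ∀ (K : ℝ), 1 ≤ K → ∃ C : ℝ, 0 < C ∧ ∀ (R : ℝ), 600 ≤ R → (∀ s : ℕ, ⌈R / 168⌉₊ ≤ 4 * (s + 1) → s ≤ 5 * ⌈R / 168⌉₊ → ∑ i ∈ Finset.range (s + 1), Literature.Probability.RandomPlanarGeometry.SAW.HV.triDl i ≤ K * ((s : ℝ) + 1) * Literature.Probability.RandomPlanarGeometry.SAW.HV.triDl s) → ∀ (x : Literature.Probability.LatticeModels.Site 2) (B : Finset Literature.Probability.LatticeModels.HexVertex) (S' : Finset ℤ), (∀ v : Literature.Probability.LatticeModels.HexVertex, v ∈ B ↔ (x 1 ≤ v.1 1 ∧ dist (Literature.Probability.LatticeModels.hexCenter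 v) (Literature.Probability.RandomPlanarGeometry.SAW.hexMidpoint s((x - Pi.single 1 1, 1), (x, 0))) ≤ R)) → (∀ d : ℤ, d ∈ S' ↔ ((1 / 168 : ℝ) * R ≤ (d : ℝ) ∧ (d : ℝ) ≤ (1 / 4 : ℝ) * R)) → Literature.Probability.RandomPlanarGeometry.SAW.HV.triDl ⌊R / 4⌋₊ ≤ C * ∑ d ∈ S', ∑ γ : Literature.Probability.RandomPlanarGeometry.SAW.HexMidEdgeSAW B s((x - Pi.single 1 1, 1), (x, 0)) s((x + Pi.single 0 d - Pi.single 1 1, 1), (x + Pi.single 0 d, 0)), Literature.Probability.RandomPlanarGeometry.SAW.hexCriticalFugacity ^ γ.length :=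
  windowTwoPointLowerBoundAt_of_regNear

end Summit.CriticalPhenomena.SAWScalingLimit.Theorems.HexConjecture.RootLocality

end
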